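import Mathlib.Analysis.SpecialFunctions.SmoothTransition
import Mathlib.Analysis.SpecialFunctions.Pow.Deriv
import Mathlib.Analysis.SpecialFunctions.Trigonometric.InverseDeriv
import Mathlib.Analysis.SpecialFunctions.Trigonometric.ArctanDeriv
import Mathlib.MeasureTheory.Integral.IntervalIntegral.FundThmCalculus
import Mathlib.Analysis.Calculus.Deriv.MeanValue
import HarnessLib

/-!
# The bending profile of the surrounding construction: explicit smooth steps and clamps

Topic `Geometry/Riemannian` (fact seat
`provefact-Literature.Geometry.Riemannian.LawsonMichelsohn1984_surrounding`).  Everything here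
is **proved**; no definitions.

The mean-convex attachment of a handle of codimension `k ≥ 2` (Lawson–Michelsohn 1984, Thm. 3.1;
Gromov 2018, §5, the "staircase" bending of Gromov–Lawson) replaces, near the attaching sphere,
the pair (mean-convex hypersurface `Σ`, `ε`-tube around the core disc) by one hypersurface
`{(σ, t, y) : (|y|, t) ∈ γ}` for a plane curve `γ` whose flat-model mean curvature is
`(k - 1) sin θ / r - θ'` (`θ` the angle with `Σ`, `r = |y|`).  The curve is built from explicit
smooth steps; this file provides them, with the uniform derivative bounds that the curvature
budget requires:

* `exists_deriv_smoothTransition_bound` — `|smoothTransition'| ≤ K₀` for a constant `K₀`;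
* `exists_stepDown` — for `a < b` a `C^∞` antitone step `S = 1` on `(-∞, a]`, `S = 0` on
  `[b, ∞)`, `0 ≤ S ≤ 1`, with `|S'| ≤ K₀ / (b - a)`;
* `exists_clampUp` — a `C^∞` concave clamp `C` with `C u = u` for `u ≤ a`, `C` constant on
  `[b, ∞)`, `0 ≤ C' ≤ 1`, and `u C'(u) ≤ C(u)` for `u ≥ 0` (logarithmic slope `≤ 1`);
* `exists_clampDown` — a `C^∞` clamp `C` with `C` constant on `(-∞, a]`, `C v = v` for `v ≥ b`,
  `0 ≤ C' ≤ 1` and `v ≤ C v`.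

## References

* H. B. Lawson, Jr., M.-L. Michelsohn, *Embedding and surrounding with positive mean curvature*,
  Invent. Math. 77 (1984), §3. [LawsonMichelsohn1984]
* M. Gromov, *Mean curvature in the light of scalar curvature*, arXiv:1812.09731 (2018; Ann. Inst. Fourier 2019),
  §5 (thin mean-convex neighbourhoods; attachment lemma). [Gromov2018MeanCurvature]
-/

noncomputable section

open Set Function Filter MeasureTheory intervalIntegral
open scoped Topology ContDiff

namespace Literature.Geometry.Riemannian

/-! ### The derivative of the smooth transition is bounded -/

/-- The derivative of `Real.smoothTransition` vanishes off `[0, 1]`. [folklore] -/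
theorem deriv_smoothTransition_eq_zero_of_notMem {x : ℝ} (hx : x ∉ Icc (0 : ℝ) 1) :
    deriv Real.smoothTransition x = 0 := by
  rw [mem_Icc, not_and_or, not_le, not_le] at hx
  rcases hx with hx | hx
  · have hev : Real.smoothTransition =ᶠ[𝓝 x] fun _ => (0 : ℝ) :=
      (isOpen_Iio.eventually_mem hx).mono fun y hy => Real.smoothTransition.zero_of_nonpos hy.le
    rw [hev.deriv_eq, deriv_const]
  · have hev : Real.smoothTransition =ᶠ[𝓝 x] fun _ => (1 : ℝ) :=
      (isOpen_Ioi.eventually_mem hx).mono fun y hy => Real.smoothTransition.one_of_one_le hy.le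
    rw [hev.deriv_eq, deriv_const]

/-- **The derivative of the smooth transition is bounded**: `|smoothTransition' x| ≤ K₀` for all
`x`, for some `K₀ ≥ 1`. [folklore] -/
theorem exists_deriv_smoothTransition_bound :
    ∃ K₀ : ℝ, 1 ≤ K₀ ∧ ∀ x, |deriv Real.smoothTransition x| ≤ K₀ := by
  have hc : Continuous (deriv Real.smoothTransition) :=
    (Real.smoothTransition.contDiff (n := 1)).continuous_deriv le_rfl
  obtain ⟨K, hK⟩ := isCompact_Icc.exists_bound_of_continuousOn (hc.continuousOn (s := Icc (0 : ℝ) 1))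
  refine ⟨max K 1, le_max_right _ _, fun x => ?_⟩
  by_cases hx : x ∈ Icc (0 : ℝ) 1
  · exact ((Real.norm_eq_abs _).symm.le.trans (hK x hx)).trans (le_max_left _ _)
  · rw [deriv_smoothTransition_eq_zero_of_notMem hx, abs_zero]; positivity

/-! ### Smooth steps with derivative bounds -/

/-- **A smooth step down with controlled slope.**  For `a < b` there is a `C^∞` antitone
`S : ℝ → [0, 1]` with `S = 1` on `(-∞, a]`, `S = 0` on `[b, ∞)` and `|S'| ≤ K₀ / (b - a)`
(`S x = smoothTransition ((b - x)/(b - a))`). [folklore] -/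
theorem exists_stepDown {K₀ : ℝ} (hK₀ : ∀ x, |deriv Real.smoothTransition x| ≤ K₀) {a b : ℝ}
    (hab : a < b) :
    ∃ S : ℝ → ℝ, ContDiff ℝ ∞ S ∧ Antitone S ∧ (∀ x, S x ∈ Icc (0 : ℝ) 1) ∧
      (∀ x, x ≤ a → S x = 1) ∧ (∀ x, b ≤ x → S x = 0) ∧ (∀ x, |deriv S x| ≤ K₀ / (b - a)) ∧
      ∀ x, HasDerivAt S (-(deriv Real.smoothTransition ((b - x) / (b - a)) / (b - a))) x := by
  have hba : 0 < b - a := by linarith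
  set S : ℝ → ℝ := fun x => Real.smoothTransition ((b - x) / (b - a)) with hS
  have hlin : ∀ x, HasDerivAt (fun x : ℝ => (b - x) / (b - a)) (-(1 / (b - a))) x := fun x => by
    have h := ((hasDerivAt_id x).const_sub b).div_const (b - a)
    simpa [neg_div] using h
  have hder : ∀ x, HasDerivAt S (-(deriv Real.smoothTransition ((b - x) / (b - a)) / (b - a))) x := by
    intro x
    have hd : HasDerivAt Real.smoothTransition (deriv Real.smoothTransition ((b - x) / (b - a)))
        ((b - x) / (b - a)) :=
      ((Real.smoothTransition.contDiff (n := 1)).differentiable one_ne_zero _).hasDerivAt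
    have h := hd.comp x (hlin x)
    have heq : deriv Real.smoothTransition ((b - x) / (b - a)) * -(1 / (b - a)) =
        -(deriv Real.smoothTransition ((b - x) / (b - a)) / (b - a)) := by ring
    rw [heq] at h
    exact h
  refine ⟨S, ?_, ?_, fun x => ⟨Real.smoothTransition.nonneg _, Real.smoothTransition.le_one _⟩,
    fun x hx => ?_, fun x hx => ?_, fun x => ?_, hder⟩
  · exact Real.smoothTransition.contDiff.comp ((contDiff_const.sub contDiff_id).div_const _)
  · exact fun x y hxy => Real.smoothTransition.monotone (by
      show (b - y) / (b - a) ≤ (b - x) / (b - a)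
      exact div_le_div_of_nonneg_right (by linarith) hba.le)
  · exact Real.smoothTransition.one_of_one_le (by rw [le_div_iff₀ hba]; linarith)
  · exact Real.smoothTransition.zero_of_nonpos (div_nonpos_of_nonpos_of_nonneg (by linarith) hba.le)
  · rw [(hder x).deriv, abs_neg, abs_div, abs_of_pos hba]
    exact div_le_div_of_nonneg_right (hK₀ _) hba.le

/-! ### Primitives of smooth bounded functions -/

/-- The primitive `u ↦ ∫₀ᵘ g` of a `C^∞` function is `C^∞`, with derivative `g`. [folklore] -/
theorem contDiff_primitive {g : ℝ → ℝ} (hg : ContDiff ℝ ∞ g) :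
    ContDiff ℝ ∞ (fun u => ∫ v in (0 : ℝ)..u, g v) ∧
      ∀ u, HasDerivAt (fun u => ∫ v in (0 : ℝ)..u, g v) (g u) u := by
  have hgc : Continuous g := hg.continuous
  have hder : ∀ u, HasDerivAt (fun u => ∫ v in (0 : ℝ)..u, g v) (g u) u := fun u =>
    intervalIntegral.integral_hasDerivAt_right (hgc.intervalIntegrable _ _)
      hgc.aestronglyMeasurable.stronglyMeasurableAtFilter hgc.continuousAt
  refine ⟨?_, hder⟩
  rw [contDiff_infty_iff_deriv]
  refine ⟨fun u => (hder u).differentiableAt, ?_⟩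
  have : deriv (fun u => ∫ v in (0 : ℝ)..u, g v) = g := funext fun u => (hder u).deriv
  rw [this]; exact hg

/-! ### Clamps -/

/-- **The concave clamp from above.**  For `0 < a < b` there is a `C^∞` function `C` with
`C u = u` for `u ≤ a`, `C` constant on `[b, ∞)` (with value in `[a, b]`), `0 ≤ C' ≤ 1`,
`C' ` antitone, `C u ≤ u` for `0 ≤ u`, `0 < C u` for `0 < u`, and the logarithmic-slope bound
`u C'(u) ≤ C(u)` for `0 ≤ u` (`C = ∫₀ S` for a step `S`). [folklore] -/
theorem exists_clampUp {K₀ : ℝ} (hK₀ : ∀ x, |deriv Real.smoothTransition x| ≤ K₀) {a b : ℝ}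
    (ha : 0 < a) (hab : a < b) :
    ∃ (C : ℝ → ℝ) (c : ℝ), ContDiff ℝ ∞ C ∧ a ≤ c ∧ c ≤ b ∧ (∀ u, u ≤ a → C u = u) ∧
      (∀ u, b ≤ u → C u = c) ∧ (∀ u, deriv C u ∈ Icc (0 : ℝ) 1) ∧ Antitone (deriv C) ∧
      (∀ u, HasDerivAt C (deriv C u) u) ∧ (∀ u, 0 ≤ u → C u ≤ u) ∧ (∀ u, 0 < u → 0 < C u) ∧
      (∀ u, 0 ≤ u → u * deriv C u ≤ C u) ∧ ∀ u, C u ≤ c := by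
  obtain ⟨S, hSc, hSanti, hS01, hS1, hS0, -, -⟩ := exists_stepDown hK₀ hab
  obtain ⟨hCc, hCder⟩ := contDiff_primitive hSc
  set C : ℝ → ℝ := fun u => ∫ v in (0 : ℝ)..u, S v with hC
  have hderiv : deriv C = S := funext fun u => (hCder u).deriv
  have hSi : ∀ x y, IntervalIntegrable S volume x y := fun x y =>
    hSc.continuous.intervalIntegrable _ _
  -- values below `a`
  have hlow : ∀ u, u ≤ a → C u = u := by
    intro u hu
    show ∫ v in (0 : ℝ)..u, S v = u
    have : ∫ v in (0 : ℝ)..u, S v = ∫ v in (0 : ℝ)..u, (1 : ℝ) := by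
      refine integral_congr fun v hv => hS1 v ?_
      rcases le_total 0 u with h0u | hu0
      · rw [uIcc_of_le h0u] at hv; exact hv.2.trans hu
      · rw [uIcc_of_ge hu0] at hv; linarith [hv.2, ha]
    rw [this, intervalIntegral.integral_const, smul_eq_mul, mul_one, sub_zero]
  -- constancy above `b`
  set c : ℝ := C b with hc
  have hhigh : ∀ u, b ≤ u → C u = c := by
    intro u hu
    show ∫ v in (0 : ℝ)..u, S v = ∫ v in (0 : ℝ)..b, S v
    rw [← integral_add_adjacent_intervals (hSi 0 b) (hSi b u)]
    have : ∫ v in b..u, S v = 0 := by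
      rw [show (0 : ℝ) = ∫ v in b..u, (0 : ℝ) by simp]
      exact integral_congr fun v hv => hS0 v (by rw [uIcc_of_le hu] at hv; exact hv.1)
    rw [this, add_zero]
  -- monotonicity facts
  have hmono : Monotone C := monotone_of_hasDerivAt_nonneg hCder fun u => by
    show 0 ≤ S u; exact (hS01 u).1
  have hsub : Antitone fun u => C u - u := antitone_of_hasDerivAt_nonpos
    (fun u => (hCder u).sub (hasDerivAt_id u)) fun u => by
      show S u - 1 ≤ 0; linarith [(hS01 u).2]
  have hC0 : C 0 = 0 := by show ∫ v in (0 : ℝ)..0, S v = 0; exact integral_same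
  refine ⟨C, c, hCc, ?_, ?_, hlow, hhigh, fun u => by rw [hderiv]; exact hS01 u,
    by rw [hderiv]; exact hSanti, fun u => by rw [hderiv]; exact hCder u, ?_, ?_, ?_, ?_⟩
  · -- `a ≤ c`
    rw [hc, ← hlow a le_rfl]; exact hmono hab.le
  · -- `c ≤ b`
    have := hsub (show (0 : ℝ) ≤ b by linarith)
    simp only [hC0, sub_zero] at this
    rw [hc]; linarith
  · -- `C u ≤ u`
    intro u hu
    have := hsub hu
    simp only [hC0, sub_zero] at this
    linarith
  · -- `0 < C u`
    intro u hu
    rcases le_or_gt u a with h | h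
    · rw [hlow u h]; exact hu
    · calc (0 : ℝ) < a := ha
        _ = C a := (hlow a le_rfl).symm
        _ ≤ C u := hmono h.le
  · -- logarithmic slope: concavity `C 0 ≥ C u + C' u (0 - u)`
    intro u hu
    rw [hderiv]
    -- `C u - u S u = ∫₀ᵘ (S v - S u) dv ≥ 0` since `S` is antitone
    have h1 : ∫ v in (0 : ℝ)..u, S u = u * S u := by
      rw [intervalIntegral.integral_const, smul_eq_mul, sub_zero]
    have h2 : u * S u ≤ ∫ v in (0 : ℝ)..u, S v := by
      rw [← h1]
      exact intervalIntegral.integral_mono_on hu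
        (intervalIntegrable_const (μ := volume) (a := 0) (b := u) (c := S u)) (hSi 0 u)
        fun v hv => hSanti hv.2
    exact h2
  · intro u
    rcases le_or_gt b u with h | h
    · rw [hhigh u h]
    · rw [hc]; exact hmono h.le

/-- **The clamp from below.**  For `a < b` there is a `C^∞` function `C` with `C` constant
(`= c ∈ [a, b]`) on `(-∞, a]`, `C v = v` for `v ≥ b`, `0 ≤ C' ≤ 1`, `v ≤ C v` and `c ≤ C v`
everywhere (`C v = b - ∫ᵥᵇ (1 - S)` for a step `S`). [folklore] -/
theorem exists_clampDown {K₀ : ℝ} (hK₀ : ∀ x, |deriv Real.smoothTransition x| ≤ K₀) {a b : ℝ}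
    (hab : a < b) :
    ∃ (C : ℝ → ℝ) (c : ℝ), ContDiff ℝ ∞ C ∧ a ≤ c ∧ c ≤ b ∧ (∀ v, v ≤ a → C v = c) ∧
      (∀ v, b ≤ v → C v = v) ∧ (∀ v, deriv C v ∈ Icc (0 : ℝ) 1) ∧
      (∀ v, HasDerivAt C (deriv C v) v) ∧ (∀ v, v ≤ C v) ∧ (∀ v, c ≤ C v) ∧ Monotone C := by
  obtain ⟨S, hSc, -, hS01, hS1, hS0, -, -⟩ := exists_stepDown hK₀ hab
  -- `D = 1 - S`: `0` below `a`, `1` above `b`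
  have hDc : ContDiff ℝ ∞ fun v => 1 - S v := contDiff_const.sub hSc
  obtain ⟨hPc, hPder⟩ := contDiff_primitive hDc
  -- `C v = b - P b + P v` where `P = ∫₀ (1 - S)`
  set P : ℝ → ℝ := fun u => ∫ v in (0 : ℝ)..u, (1 - S v) with hP
  set C : ℝ → ℝ := fun v => b - P b + P v with hC
  have hCder : ∀ v, HasDerivAt C (1 - S v) v := fun v => by
    have := (hPder v).const_add (b - P b)
    exact this
  have hderiv : ∀ v, deriv C v = 1 - S v := fun v => (hCder v).deriv
  have hIi : ∀ x y, IntervalIntegrable (fun v => 1 - S v) volume x y := fun x y =>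
    hDc.continuous.intervalIntegrable _ _
  have hmono : Monotone C := monotone_of_hasDerivAt_nonneg hCder fun v => by
    show 0 ≤ 1 - S v; linarith [(hS01 v).2]
  have hanti : Antitone fun v => C v - v := antitone_of_hasDerivAt_nonpos
    (fun v => (hCder v).sub (hasDerivAt_id v)) fun v => by
      show 1 - S v - 1 ≤ 0; linarith [(hS01 v).1]
  have hCb : C b = b := by show b - P b + P b = b; ring
  -- above `b`: `C v = v`
  have hhigh : ∀ v, b ≤ v → C v = v := by
    intro v hv
    show b - P b + P v = v
    have hsplit : P v = P b + ∫ w in b..v, (1 - S w) := by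
      show ∫ w in (0 : ℝ)..v, (1 - S w) = (∫ w in (0 : ℝ)..b, (1 - S w)) + ∫ w in b..v, (1 - S w)
      rw [integral_add_adjacent_intervals (hIi 0 b) (hIi b v)]
    have hone : ∫ w in b..v, (1 - S w) = v - b := by
      have : ∫ w in b..v, (1 - S w) = ∫ w in b..v, (1 : ℝ) :=
        integral_congr fun w hw => by
          rw [uIcc_of_le hv] at hw
          show 1 - S w = 1
          rw [hS0 w hw.1, sub_zero]
      rw [this, intervalIntegral.integral_const, smul_eq_mul, mul_one]
    rw [hsplit, hone]; ring
  -- below `a`: constant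
  set c : ℝ := C a with hc
  have hlow : ∀ v, v ≤ a → C v = c := by
    intro v hv
    show b - P b + P v = b - P b + P a
    have hsplit : P a = P v + ∫ w in v..a, (1 - S w) := by
      show ∫ w in (0 : ℝ)..a, (1 - S w) = (∫ w in (0 : ℝ)..v, (1 - S w)) + ∫ w in v..a, (1 - S w)
      rw [integral_add_adjacent_intervals (hIi 0 v) (hIi v a)]
    have hzero : ∫ w in v..a, (1 - S w) = 0 := by
      have : ∫ w in v..a, (1 - S w) = ∫ w in v..a, (0 : ℝ) :=
        integral_congr fun w hw => by
          rw [uIcc_of_le hv] at hw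
          show 1 - S w = 0
          rw [hS1 w hw.2, sub_self]
      rw [this, intervalIntegral.integral_const, smul_eq_mul, mul_zero]
    rw [hsplit, hzero, add_zero]
  refine ⟨C, c, ?_, ?_, ?_, hlow, hhigh, fun v => by rw [hderiv]; exact ⟨by linarith [(hS01 v).2],
    by linarith [(hS01 v).1]⟩, fun v => by rw [hderiv]; exact hCder v, ?_, ?_, hmono⟩
  · exact contDiff_const.add hPc
  · -- `a ≤ c`: `C a - a ≥ C b - b = 0`
    have := hanti hab.le
    simp only [hCb, sub_self] at this
    rw [hc]; linarith
  · -- `c ≤ b`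
    rw [hc, ← hCb]; exact hmono hab.le
  · intro v
    rcases le_or_gt v b with h | h
    · have := hanti h
      simp only [hCb, sub_self] at this
      linarith
    · rw [hhigh v h.le]
  · intro v
    rcases le_or_gt v a with h | h
    · rw [hlow v h]
    · rw [hc]; exact hmono h.le

/-! ### The sine profile of the middle zone -/

/-- **The sine profile of the middle zone.**  Given the budget exponent `β' > 0`, a scale
`r_f > 0` and clamp levels `0 < a₂ < b₂ ≤ a₁ < b₁ < 1`, there is a `C^∞` function `σ` on
`(0, ∞)` (the sine of the angle of the profile with the hypersurface, as a function of the distance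
`r` to the core) with: `σ` antitone, values in `[c₂, c₁] ⊆ [a₂, b₁]`, `σ = c₁` for
`0 < r ≤ r_f b₁^{-1/β'}` (the straight segment before the chimney), `σ = c₂` for
`r ≥ r_f a₂^{-1/β'}` (the straight segment before the far zone), and **the budget inequality
`|σ'(r)| ≤ β' σ(r) / r`** — so that the flat-model mean curvature `(k - 1) sin θ / r - θ'` of the
profile is `≥ (k - 1 - β') σ / r` (it is the critical profile `sin θ = (r_f/r)^{β'}` clamped at both
ends by clamps of logarithmic slope `≤ 1`). [cite: LawsonMichelsohn1984, §3] -/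
theorem exists_sineProfile {K₀ : ℝ} (hK₀ : ∀ x, |deriv Real.smoothTransition x| ≤ K₀)
    {β' r_f a₁ b₁ a₂ b₂ : ℝ} (hβ' : 0 < β') (hr_f : 0 < r_f) (ha₂ : 0 < a₂) (hab₂ : a₂ < b₂)
    (hba : b₂ ≤ a₁) (hab₁ : a₁ < b₁) :
    ∃ (σ : ℝ → ℝ) (c₁ c₂ : ℝ), ContDiffOn ℝ ∞ σ (Ioi 0) ∧ a₁ ≤ c₁ ∧ c₁ ≤ b₁ ∧ a₂ ≤ c₂ ∧
      c₂ ≤ b₂ ∧ (∀ r, 0 < r → σ r ∈ Icc c₂ c₁) ∧ AntitoneOn σ (Ioi 0) ∧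
      (∀ r, 0 < r → r ≤ r_f * b₁ ^ (-(1 / β')) → σ r = c₁) ∧
      (∀ r, r_f * a₂ ^ (-(1 / β')) ≤ r → σ r = c₂) ∧
      (∀ r, 0 < r → HasDerivAt σ (deriv σ r) r) ∧
      ∀ r, 0 < r → |deriv σ r| ≤ β' * σ r / r := by
  obtain ⟨C₁, c₁, hC₁c, ha₁c₁, hc₁b₁, hC₁low, hC₁high, hC₁', -, hC₁der, hC₁le, hC₁pos, hC₁log, hC₁lec⟩ :=
    exists_clampUp hK₀ (by linarith) hab₁
  obtain ⟨C₂, c₂, hC₂c, ha₂c₂, hc₂b₂, hC₂low, hC₂high, hC₂', hC₂der, hC₂ge, hC₂gec, hC₂mono⟩ :=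
    exists_clampDown hK₀ hab₂
  -- the critical profile `u r = (r_f / r) ^ β' = exp (β' (log r_f - log r))`
  set u : ℝ → ℝ := fun r => Real.exp (β' * (Real.log r_f - Real.log r)) with hu
  have hupos : ∀ r, 0 < u r := fun r => Real.exp_pos _
  have huder : ∀ r, 0 < r → HasDerivAt u (-(β' / r) * u r) r := by
    intro r hr
    have h1 : HasDerivAt (fun r => β' * (Real.log r_f - Real.log r)) (β' * (0 - r⁻¹)) r :=
      ((hasDerivAt_const r _).sub (Real.hasDerivAt_log hr.ne')).const_mul β'
    have h2 := (Real.hasDerivAt_exp _).comp r h1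
    have heq : Real.exp (β' * (Real.log r_f - Real.log r)) * (β' * (0 - r⁻¹)) =
        -(β' / r) * u r := by rw [hu]; field_simp; ring
    rw [heq] at h2
    exact h2
  have hueq : ∀ r, 0 < r → u r = (r_f / r) ^ β' := fun r hr => by
    rw [hu]; dsimp only
    rw [← Real.log_div hr_f.ne' hr.ne', Real.rpow_def_of_pos (div_pos hr_f hr), mul_comm]
  have huc : ContDiffOn ℝ ∞ u (Ioi 0) := by
    refine Real.contDiff_exp.comp_contDiffOn ?_
    exact contDiffOn_const.mul (contDiffOn_const.sub (Real.contDiffOn_log.mono fun r hr => ne_of_gt hr))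
  -- `u` is antitone on `(0, ∞)`; its level sets
  have hu_anti : ∀ r r', 0 < r → r ≤ r' → u r' ≤ u r := fun r r' hr hrr' => by
    rw [hu]; dsimp only
    refine Real.exp_le_exp.2 (mul_le_mul_of_nonneg_left ?_ hβ'.le)
    linarith [Real.log_le_log hr hrr']
  have hlevel : ∀ r q, 0 < r → 0 < q → (u r ≤ q ↔ r_f * q ^ (-(1 / β')) ≤ r) := by
    intro r q hr hq
    rw [hueq r hr]
    have hq' : 0 < q ^ (-(1 / β')) := Real.rpow_pos_of_pos hq _
    constructor
    · intro h
      -- `(r_f/r)^β' ≤ q` ⇒ `r_f / r ≤ q^{1/β'}` ⇒ `r_f q^{-1/β'} ≤ r`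
      have h1 : r_f / r ≤ q ^ (1 / β') := by
        have := Real.rpow_le_rpow (Real.rpow_nonneg (div_pos hr_f hr).le _) h
          (show (0 : ℝ) ≤ 1 / β' by positivity)
        rwa [← Real.rpow_mul (div_pos hr_f hr).le, mul_one_div_cancel hβ'.ne', Real.rpow_one] at this
      rw [div_le_iff₀ hr] at h1
      have h2 : r_f * q ^ (-(1 / β')) ≤ q ^ (1 / β') * r * q ^ (-(1 / β')) :=
        mul_le_mul_of_nonneg_right h1 hq'.le
      calc r_f * q ^ (-(1 / β')) ≤ q ^ (1 / β') * r * q ^ (-(1 / β')) := h2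
        _ = r * (q ^ (1 / β') * q ^ (-(1 / β'))) := by ring
        _ = r := by rw [← Real.rpow_add hq, add_neg_cancel, Real.rpow_zero, mul_one]
    · intro h
      have h1 : r_f / r ≤ q ^ (1 / β') := by
        rw [div_le_iff₀ hr]
        have : r_f = r_f * q ^ (-(1 / β')) * q ^ (1 / β') := by
          rw [mul_assoc, ← Real.rpow_add hq, neg_add_cancel, Real.rpow_zero, mul_one]
        rw [this]
        calc r_f * q ^ (-(1 / β')) * q ^ (1 / β') ≤ r * q ^ (1 / β') :=
              mul_le_mul_of_nonneg_right h (Real.rpow_nonneg hq.le _)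
          _ = q ^ (1 / β') * r := mul_comm _ _
      have := Real.rpow_le_rpow (div_pos hr_f hr).le h1 hβ'.le
      rwa [← Real.rpow_mul hq.le, one_div_mul_cancel hβ'.ne', Real.rpow_one] at this
  -- the profile
  set σ : ℝ → ℝ := fun r => C₂ (C₁ (u r)) with hσ
  have hσder : ∀ r, 0 < r →
      HasDerivAt σ (deriv C₂ (C₁ (u r)) * (deriv C₁ (u r) * (-(β' / r) * u r))) r := fun r hr =>
    (hC₂der _).comp r ((hC₁der _).comp r (huder r hr))
  have hσc : ContDiffOn ℝ ∞ σ (Ioi 0) := hC₂c.comp_contDiffOn (hC₁c.comp_contDiffOn huc)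
  refine ⟨σ, c₁, c₂, hσc, ha₁c₁, hc₁b₁, ha₂c₂, hc₂b₂, fun r hr => ?_, ?_, fun r hr hrb => ?_,
    fun r hra => ?_, fun r hr => (hσder r hr).differentiableAt.hasDerivAt, fun r hr => ?_⟩
  · -- values in `[c₂, c₁]`
    refine ⟨hC₂gec _, ?_⟩
    show C₂ (C₁ (u r)) ≤ c₁
    have h1 : C₁ (u r) ≤ c₁ := hC₁lec _
    have h2 : c₁ = C₂ c₁ := (hC₂high c₁ (hc₂b₂.trans (hba.trans ha₁c₁) |> fun h => by linarith)).symm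
    rw [h2]; exact hC₂mono h1
  · -- antitone
    intro r hr r' hr' hrr'
    show C₂ (C₁ (u r')) ≤ C₂ (C₁ (u r))
    have hC₁mono : Monotone C₁ := monotone_of_hasDerivAt_nonneg hC₁der fun x => (hC₁' x).1
    exact hC₂mono (hC₁mono (hu_anti r r' hr hrr'))
  · -- upper plateau: `u r ≥ b₁`
    show C₂ (C₁ (u r)) = c₁
    have hb₁pos : 0 < b₁ := by linarith
    have huthr : u (r_f * b₁ ^ (-(1 / β'))) = b₁ := by
      have hq' : 0 < b₁ ^ (-(1 / β')) := Real.rpow_pos_of_pos hb₁pos _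
      rw [hueq _ (mul_pos hr_f hq')]
      have h1 : r_f / (r_f * b₁ ^ (-(1 / β'))) = b₁ ^ (1 / β') := by
        rw [Real.rpow_neg hb₁pos.le]
        have : 0 < b₁ ^ (1 / β') := Real.rpow_pos_of_pos hb₁pos _
        field_simp
      rw [h1, ← Real.rpow_mul hb₁pos.le, one_div_mul_cancel hβ'.ne', Real.rpow_one]
    have hub : b₁ ≤ u r := by
      rcases hrb.lt_or_eq with hlt | heq
      · by_contra h
        have := (hlevel r b₁ hr hb₁pos).1 (not_le.1 h).le
        linarith
      · rw [heq, huthr]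
    rw [hC₁high _ hub]
    exact hC₂high c₁ (by linarith)
  · -- lower plateau: `u r ≤ a₂ ≤ a₁`
    have hr : 0 < r := lt_of_lt_of_le (mul_pos hr_f (Real.rpow_pos_of_pos ha₂ _)) hra
    show C₂ (C₁ (u r)) = c₂
    have hua : u r ≤ a₂ := (hlevel r a₂ hr ha₂).2 hra
    rw [hC₁low _ (hua.trans (hab₂.le.trans hba)), hC₂low _ hua]
  · -- the budget inequality
    rw [(hσder r hr).deriv]
    have h1 : |deriv C₂ (C₁ (u r))| ≤ 1 := by
      rw [abs_of_nonneg (hC₂' _).1]; exact (hC₂' _).2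
    have h2 : 0 ≤ deriv C₁ (u r) := (hC₁' _).1
    have h3 : u r * deriv C₁ (u r) ≤ C₁ (u r) := hC₁log _ (hupos r).le
    have h4 : C₁ (u r) ≤ C₂ (C₁ (u r)) := hC₂ge _
    calc |deriv C₂ (C₁ (u r)) * (deriv C₁ (u r) * (-(β' / r) * u r))|
        = |deriv C₂ (C₁ (u r))| * (deriv C₁ (u r) * ((β' / r) * u r)) := by
          rw [abs_mul]
          congr 1
          rw [abs_of_nonpos (by
            have : 0 ≤ deriv C₁ (u r) * ((β' / r) * u r) := by positivity
            nlinarith)]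
          ring
      _ ≤ 1 * (deriv C₁ (u r) * ((β' / r) * u r)) := by gcongr
      _ = β' / r * (u r * deriv C₁ (u r)) := by ring
      _ ≤ β' / r * C₂ (C₁ (u r)) := by
          exact mul_le_mul_of_nonneg_left (h3.trans h4) (by positivity)
      _ = β' * σ r / r := by rw [hσ]; ring

/-! ### The angle profile of the graph zones (middle zone and far ramp) -/

/-- **The angle profile of the graph zones.**  With the sine profile `σ` of the middle zone
(`exists_sineProfile`) and a far ramp, the angle `θ(r) = S_far(r) · arcsin σ(r)` of the bent
hypersurface with `Σ`, as a function of the distance `r` to the core, is `C^∞` on `(0, ∞)`,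
antitone, equal to `θ₁ = arcsin c₁ < π/2` near the chimney (`r ≤ r_f b₁^{-1/β'}`), to
`α = arcsin c₂` on `[R_α, R₁]` (`R_α = r_f a₂^{-1/β'}`, `R₁ = 2R_α`), ramping down to `0` on
`[R₁, R₁ + L]`, `L = α K₀ / h`, and `0` beyond; and the **flat-model mean curvature
`κ sin θ / r + cos θ · θ'`** (`κ = k - 1`) of the graph hypersurface is `≥ (κ - β') sin θ / r` on
the middle zone `r ≤ R₁` and `≥ -h` everywhere. [cite: LawsonMichelsohn1984, §3]
[cite: Gromov2018MeanCurvature, §5] -/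
theorem exists_angleProfile {K₀ : ℝ} (hK₀1 : 1 ≤ K₀)
    (hK₀ : ∀ x, |deriv Real.smoothTransition x| ≤ K₀) {κ β' h r_f a₁ b₁ a₂ b₂ : ℝ}
    (hβ' : 0 < β') (hβ'κ : β' ≤ κ) (hh : 0 < h) (hr_f : 0 < r_f) (ha₂ : 0 < a₂) (hab₂ : a₂ < b₂)
    (hba : b₂ ≤ a₁) (hab₁ : a₁ < b₁) (hb₁ : b₁ < 1) :
    ∃ (θ : ℝ → ℝ) (θ₁ α L : ℝ), ContDiffOn ℝ ∞ θ (Ioi 0) ∧ 0 < α ∧ α ≤ θ₁ ∧ θ₁ < Real.pi / 2 ∧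
      Real.sin θ₁ ∈ Icc a₁ b₁ ∧ Real.sin α ∈ Icc a₂ b₂ ∧ L = α * K₀ / h ∧
      (∀ r, 0 < r → θ r ∈ Icc 0 θ₁) ∧ AntitoneOn θ (Ioi 0) ∧
      (∀ r, 0 < r → r ≤ r_f * b₁ ^ (-(1 / β')) → θ r = θ₁) ∧
      (∀ r, r_f * a₂ ^ (-(1 / β')) ≤ r → r ≤ 2 * (r_f * a₂ ^ (-(1 / β'))) → θ r = α) ∧
      (∀ r, 2 * (r_f * a₂ ^ (-(1 / β'))) + L ≤ r → θ r = 0) ∧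
      (∀ r, 0 < r → HasDerivAt θ (deriv θ r) r) ∧
      (∀ r, 0 < r → -h ≤ κ * Real.sin (θ r) / r + Real.cos (θ r) * deriv θ r) ∧
      (∀ r, 0 < r → r < 2 * (r_f * a₂ ^ (-(1 / β'))) →
        (κ - β') * Real.sin (θ r) / r ≤ κ * Real.sin (θ r) / r + Real.cos (θ r) * deriv θ r) := by
  obtain ⟨σ, c₁, c₂, hσc, ha₁c₁, hc₁b₁, ha₂c₂, hc₂b₂, hσI, hσanti, hσtop, hσbot, hσder, hσbudget⟩ :=
    exists_sineProfile hK₀ hβ' hr_f ha₂ hab₂ hba hab₁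
  set R_α : ℝ := r_f * a₂ ^ (-(1 / β')) with hR_α
  have hR_αpos : 0 < R_α := mul_pos hr_f (Real.rpow_pos_of_pos ha₂ _)
  set R₁ : ℝ := 2 * R_α with hR₁
  set θ₁ : ℝ := Real.arcsin c₁ with hθ₁
  set α : ℝ := Real.arcsin c₂ with hα
  have hc₂pos : 0 < c₂ := ha₂.trans_le ha₂c₂
  have hc₁pos : 0 < c₁ := by linarith
  have hc₁lt : c₁ < 1 := hc₁b₁.trans_lt hb₁
  have hc₂lt : c₂ < 1 := by linarith
  have hc₂c₁ : c₂ ≤ c₁ := hc₂b₂.trans (hba.trans ha₁c₁)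
  have hαpos : 0 < α := Real.arcsin_pos.2 hc₂pos
  have hαθ₁ : α ≤ θ₁ := Real.arcsin_le_arcsin hc₂c₁
  have hθ₁lt : θ₁ < Real.pi / 2 := Real.arcsin_lt_pi_div_two.2 hc₁lt
  set L : ℝ := α * K₀ / h with hL
  have hLpos : 0 < L := by positivity
  obtain ⟨S, hSc, hSanti, hS01, hS1, hS0, hSder, hSder'⟩ :=
    exists_stepDown hK₀ (show R₁ < R₁ + L by linarith)
  set θ : ℝ → ℝ := fun r => S r * Real.arcsin (σ r) with hθ
  -- `arcsin ∘ σ` is smooth on `(0, ∞)` (values of `σ` in `(0, 1)`)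
  have harcsin : ∀ r, 0 < r → HasDerivAt (fun r => Real.arcsin (σ r))
      (1 / Real.sqrt (1 - σ r ^ 2) * deriv σ r) r := fun r hr => by
    have h1 := Real.hasDerivAt_arcsin (x := σ r) (by linarith [(hσI r hr).1]) (by linarith [(hσI r hr).2])
    exact h1.comp r (hσder r hr)
  have harcsin_c : ContDiffOn ℝ ∞ (fun r => Real.arcsin (σ r)) (Ioi 0) := by
    refine ContDiffOn.comp (g := Real.arcsin) (t := Ioo (-1) 1) ?_ hσc fun r hr => ?_
    · exact fun x hx => (Real.contDiffAt_arcsin (by linarith [hx.1]) (by linarith [hx.2])).contDiffWithinAt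
    · exact ⟨by linarith [(hσI r hr).1], by linarith [(hσI r hr).2]⟩
  have hθc : ContDiffOn ℝ ∞ θ (Ioi 0) := (hSc.contDiffOn).mul harcsin_c
  have hθder : ∀ r, 0 < r → HasDerivAt θ
      (deriv S r * Real.arcsin (σ r) + S r * (1 / Real.sqrt (1 - σ r ^ 2) * deriv σ r)) r :=
    fun r hr => (hSder' r |>.differentiableAt.hasDerivAt).mul (harcsin r hr)
  -- ranges of `arcsin σ`
  have harc_mem : ∀ r, 0 < r → Real.arcsin (σ r) ∈ Icc α θ₁ := fun r hr =>
    ⟨Real.arcsin_le_arcsin (hσI r hr).1, Real.arcsin_le_arcsin (hσI r hr).2⟩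
  -- on `[R_α, ∞)`: `σ = c₂`, so `arcsin σ = α`
  have harc_far : ∀ r, R_α ≤ r → Real.arcsin (σ r) = α := fun r hr => by rw [hσbot r hr]
  -- on `(0, R₁]`: `S = 1`
  have hS_mid : ∀ r, r ≤ R₁ → S r = 1 := fun r hr => hS1 r hr
  -- `sin θ ≥ 0`
  have hsin_nonneg : ∀ r, 0 < r → 0 ≤ Real.sin (θ r) := by
    intro r hr
    have hm := harc_mem r hr
    refine Real.sin_nonneg_of_nonneg_of_le_pi (mul_nonneg (hS01 r).1 (hαpos.le.trans hm.1)) ?_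
    have hθle : θ r ≤ θ₁ := by
      calc S r * Real.arcsin (σ r) ≤ 1 * Real.arcsin (σ r) :=
            mul_le_mul_of_nonneg_right (hS01 r).2 (hαpos.le.trans hm.1)
        _ ≤ θ₁ := by rw [one_mul]; exact hm.2
    linarith [Real.pi_pos]
  -- the middle-zone bound, for `r < R₁` (where `S = 1` near `r`)
  have hmid : ∀ r, 0 < r → r < R₁ →
      (κ - β') * Real.sin (θ r) / r ≤ κ * Real.sin (θ r) / r + Real.cos (θ r) * deriv θ r := by
    intro r hr h1
    rw [(hθder r hr).deriv]
    have hS1r : S r = 1 := hS_mid r h1.le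
    have hS'0 : deriv S r = 0 := by
      have hev : S =ᶠ[𝓝 r] fun _ => (1 : ℝ) :=
        (isOpen_Iio.eventually_mem h1).mono fun y hy => hS_mid y hy.le
      rw [hev.deriv_eq, deriv_const]
    have hσ1 : σ r < 1 := (hσI r hr).2.trans_lt hc₁lt
    have hσpos : 0 < σ r := hc₂pos.trans_le (hσI r hr).1
    have hsin : Real.sin (θ r) = σ r := by
      show Real.sin (S r * Real.arcsin (σ r)) = σ r
      rw [hS1r, one_mul, Real.sin_arcsin (by linarith) hσ1.le]
    have hcos : Real.cos (θ r) = Real.sqrt (1 - σ r ^ 2) := by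
      show Real.cos (S r * Real.arcsin (σ r)) = _
      rw [hS1r, one_mul, Real.cos_arcsin]
    have hsqrt : 0 < Real.sqrt (1 - σ r ^ 2) := Real.sqrt_pos.2 (by nlinarith)
    rw [hsin, hcos, hS'0, hS1r, zero_mul, zero_add, one_mul]
    have hsimp : Real.sqrt (1 - σ r ^ 2) * (1 / Real.sqrt (1 - σ r ^ 2) * deriv σ r) = deriv σ r := by
      field_simp
    rw [hsimp]
    have hb : -(β' * σ r / r) ≤ deriv σ r := (abs_le.1 (hσbudget r hr)).1
    have : (κ - β') * σ r / r = κ * σ r / r - β' * σ r / r := by ring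
    rw [this]
    linarith
  refine ⟨θ, θ₁, α, L, hθc, hαpos, hαθ₁, hθ₁lt, ?_, ?_, rfl, fun r hr => ?_, ?_, fun r hr hrb => ?_,
    fun r h1 h2 => ?_, fun r hr2 => ?_, fun r hr => (hθder r hr).differentiableAt.hasDerivAt,
    fun r hr => ?_, fun r hr hr1 => ?_⟩
  · rw [hθ₁, Real.sin_arcsin (by linarith) hc₁lt.le]; exact ⟨ha₁c₁, hc₁b₁⟩
  · rw [hα, Real.sin_arcsin (by linarith) hc₂lt.le]; exact ⟨ha₂c₂, hc₂b₂⟩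
  · -- range `[0, θ₁]`
    obtain ⟨h0, h1⟩ := hS01 r
    have := harc_mem r hr
    exact ⟨mul_nonneg h0 (hαpos.le.trans this.1), by
      calc S r * Real.arcsin (σ r) ≤ 1 * Real.arcsin (σ r) :=
            mul_le_mul_of_nonneg_right h1 (hαpos.le.trans this.1)
        _ ≤ θ₁ := by rw [one_mul]; exact this.2⟩
  · -- antitone on `(0, ∞)`
    intro r hr r' hr' hrr'
    show S r' * Real.arcsin (σ r') ≤ S r * Real.arcsin (σ r)
    have h1 : Real.arcsin (σ r') ≤ Real.arcsin (σ r) := Real.arcsin_le_arcsin (hσanti hr hr' hrr')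
    have h2 : S r' ≤ S r := hSanti hrr'
    have h3 : 0 ≤ S r' := (hS01 r').1
    have h4 : 0 ≤ Real.arcsin (σ r) := hαpos.le.trans (harc_mem r hr).1
    calc S r' * Real.arcsin (σ r') ≤ S r' * Real.arcsin (σ r) := mul_le_mul_of_nonneg_left h1 h3
      _ ≤ S r * Real.arcsin (σ r) := mul_le_mul_of_nonneg_right h2 h4
  · -- chimney plateau
    show S r * Real.arcsin (σ r) = θ₁
    have hrb1 : r ≤ R₁ := by
      refine hrb.trans ?_
      -- `r_f b₁^{-1/β'} ≤ r_f a₂^{-1/β'} ≤ 2 R_α`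
      have : b₁ ^ (-(1 / β')) ≤ a₂ ^ (-(1 / β')) :=
        Real.rpow_le_rpow_of_nonpos ha₂ (by linarith) (by
          have : 0 < 1 / β' := by positivity
          linarith)
      have := mul_le_mul_of_nonneg_left this hr_f.le
      linarith
    rw [hS_mid r hrb1, one_mul, hσtop r hr hrb]
  · -- `α`-plateau on `[R_α, R₁]`
    show S r * Real.arcsin (σ r) = α
    rw [hS_mid r h2, one_mul, harc_far r h1]
  · -- zero beyond `R₁ + L`
    show S r * Real.arcsin (σ r) = 0
    rw [hS0 r hr2, zero_mul]
  · -- `H ≥ -h` everywhere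
    rcases lt_or_ge r R₁ with h1 | h1
    · have := hmid r hr h1
      have hsin0 : 0 ≤ Real.sin (θ r) := hsin_nonneg r hr
      have hκ0 : 0 ≤ κ - β' := by linarith
      have : 0 ≤ (κ - β') * Real.sin (θ r) / r := by positivity
      linarith
    · -- far zone: `σ = c₂` near `r`, `θ = α S`, `|θ'| ≤ α K₀ / L = h`
      rw [(hθder r hr).deriv]
      have h1' : R_α < r := lt_of_lt_of_le (by linarith) h1
      have hσ'0 : deriv σ r = 0 := by
        have hev' : σ =ᶠ[𝓝 r] fun _ => c₂ :=
          (isOpen_Ioi.eventually_mem h1').mono fun y hy => hσbot y hy.le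
        rw [hev'.deriv_eq, deriv_const]
      rw [hσ'0, mul_zero, mul_zero, add_zero, harc_far r h1'.le]
      have hκ0 : 0 ≤ κ := hβ'.le.trans hβ'κ
      have h2 : 0 ≤ κ * Real.sin (θ r) / r := by
        have := hsin_nonneg r hr
        positivity
      have hS' : |deriv S r| ≤ K₀ / (R₁ + L - R₁) := hSder r
      rw [add_sub_cancel_left] at hS'
      have hbound : |Real.cos (θ r) * (deriv S r * α)| ≤ h := by
        rw [abs_mul, abs_mul, abs_of_pos hαpos]
        calc |Real.cos (θ r)| * (|deriv S r| * α) ≤ 1 * (K₀ / L * α) := by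
              gcongr
              exact Real.abs_cos_le_one _
          _ = h := by rw [hL]; field_simp
      have := (abs_le.1 hbound).1
      linarith
  · exact hmid r hr hr1

/-! ### The height profile of the graph zones -/

/-- **The height profile of the graph zones.**  For an angle function `θ`, `C^∞` on `(0, ∞)` with
values in `[0, θ₁]`, `θ₁ < π/2`, vanishing on `[R₂, ∞)` (`R₂ > 0`), the height
`τ(r) = ∫ᵣ^{R₂} tan θ` of the graph `{t = τ(|y|)}` is `C^∞` on `(0, ∞)` with `τ' = -tan θ`,
`τ = 0` on `[R₂, ∞)`, and `0 ≤ τ(r) ≤ (R₂ - r) tan θ₁` on `(0, R₂]`. [folklore] -/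
theorem exists_heightProfile {θ : ℝ → ℝ} (hθc : ContDiffOn ℝ ∞ θ (Ioi 0)) {θ₁ R₂ : ℝ}
    (hθ₁ : θ₁ < Real.pi / 2) (hR₂ : 0 < R₂) (hθI : ∀ r, 0 < r → θ r ∈ Icc 0 θ₁)
    (hθ0 : ∀ r, R₂ ≤ r → θ r = 0) :
    ∃ τ : ℝ → ℝ, ContDiffOn ℝ ∞ τ (Ioi 0) ∧
      (∀ r, 0 < r → HasDerivAt τ (-Real.tan (θ r)) r) ∧ (∀ r, R₂ ≤ r → τ r = 0) ∧
      (∀ r, 0 < r → 0 ≤ τ r) ∧ ∀ r, 0 < r → r ≤ R₂ → τ r ≤ (R₂ - r) * Real.tan θ₁ := by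
  -- the integrand `tan ∘ θ`, continuous on `(0, ∞)`
  set g : ℝ → ℝ := fun v => Real.tan (θ v) with hg
  have hcos : ∀ v, 0 < v → 0 < Real.cos (θ v) := fun v hv =>
    Real.cos_pos_of_mem_Ioo ⟨by linarith [(hθI v hv).1, Real.pi_pos], (hθI v hv).2.trans_lt hθ₁⟩
  have hgc : ContDiffOn ℝ ∞ g (Ioi 0) := by
    refine ContDiffOn.comp (g := Real.tan) (t := {x | Real.cos x ≠ 0}) ?_ hθc fun v hv => (hcos v hv).ne'
    exact fun x hx => (Real.contDiffAt_tan.2 hx).contDiffWithinAt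
  have hgcont : ContinuousOn g (Ioi 0) := hgc.continuousOn
  have hgi : ∀ a b, 0 < a → 0 < b → IntervalIntegrable g volume a b := fun a b ha hb =>
    (hgcont.mono (by
      intro v hv
      rcases le_total a b with h | h
      · rw [uIcc_of_le h] at hv; exact ha.trans_le hv.1
      · rw [uIcc_of_ge h] at hv; exact hb.trans_le hv.1)).intervalIntegrable
  have hgnonneg : ∀ v, 0 < v → 0 ≤ g v := fun v hv =>
    Real.tan_nonneg_of_nonneg_of_le_pi_div_two (hθI v hv).1 ((hθI v hv).2.trans hθ₁.le)
  have hgle : ∀ v, 0 < v → g v ≤ Real.tan θ₁ := fun v hv =>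
    Real.strictMonoOn_tan.monotoneOn
      ⟨by linarith [(hθI v hv).1, Real.pi_pos], (hθI v hv).2.trans_lt hθ₁⟩
      ⟨by linarith [Real.pi_pos, (hθI v hv).1, (hθI v hv).2], hθ₁⟩ (hθI v hv).2
  -- `g = 0` on `[R₂, ∞)`
  have hg0 : ∀ v, R₂ ≤ v → g v = 0 := fun v hv => by
    show Real.tan (θ v) = 0; rw [hθ0 v hv, Real.tan_zero]
  -- the height
  set τ : ℝ → ℝ := fun r => ∫ v in r..R₂, g v with hτ
  have hτder : ∀ r, 0 < r → HasDerivAt τ (-g r) r := fun r hr =>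
    intervalIntegral.integral_hasDerivAt_left (hgi r R₂ hr hR₂)
      (hgcont.stronglyMeasurableAtFilter isOpen_Ioi _ hr) (hgcont.continuousAt (isOpen_Ioi.mem_nhds hr))
  have hτc : ContDiffOn ℝ ∞ τ (Ioi 0) := by
    rw [contDiffOn_infty_iff_deriv_of_isOpen isOpen_Ioi]
    refine ⟨fun r hr => (hτder r hr).differentiableAt.differentiableWithinAt, ?_⟩
    have : ContDiffOn ℝ ∞ (fun r => -g r) (Ioi 0) := hgc.neg
    exact this.congr fun r hr => (hτder r hr).deriv
  have hτ0 : ∀ r, R₂ ≤ r → τ r = 0 := by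
    intro r hr
    show ∫ v in r..R₂, g v = 0
    have : ∫ v in r..R₂, g v = ∫ v in r..R₂, (0 : ℝ) :=
      integral_congr fun v hv => by
        rw [uIcc_of_ge hr] at hv
        exact hg0 v hv.1
    rw [this, intervalIntegral.integral_const, smul_eq_mul, mul_zero]
  refine ⟨τ, hτc, hτder, hτ0, fun r hr => ?_, fun r hr h => ?_⟩
  · -- `0 ≤ τ r`
    rcases le_or_gt r R₂ with h | h
    · exact intervalIntegral.integral_nonneg h fun v hv => hgnonneg v (hr.trans_le hv.1)
    · rw [hτ0 r h.le]
  · -- `τ r ≤ (R₂ - r) tan θ₁`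
    have h1 : ∫ v in r..R₂, g v ≤ ∫ v in r..R₂, Real.tan θ₁ :=
      intervalIntegral.integral_mono_on h (hgi r R₂ hr hR₂) intervalIntegrable_const
        fun v hv => hgle v (hr.trans_le hv.1)
    rw [intervalIntegral.integral_const, smul_eq_mul] at h1
    exact h1

/-! ### The chimney bend: from the straight segment of angle `θ₁` to the vertical tube -/

/-- **The chimney bend.**  In the `(r, t)`-plane, the straight segment of angle `θ₁ ∈ (0, π/2)`
through `(r_b, t_b)` (as a graph `r = r_b - cot θ₁ (t - t_b)`) is bent to the vertical over the
height interval `[t₂, t₂ + T₁]`: there is a `C^∞` function `ρ` with `ρ t = r_b - cot θ₁ (t - t_b)`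
for `t ≤ t₂`, `ρ' ∈ [-cot θ₁, 0]`, `ρ` constant (`= ρinf ≥ r_b - cot θ₁ (t₂ + T₁ - t_b)`) on
`[t₂ + T₁, ∞)`, `ρ ≤ r_b` on `[t_b, ∞)`, and `0 ≤ ρ'' ≤ cot θ₁ · K₀ / T₁` — the curvature spent in
the bend is at most `cot θ₁ K₀ / T₁`, to be paid from the budget `(k - 1)/r` of the chimney
(`ρ' = -cot θ₁ · S` for a step `S`). [cite: LawsonMichelsohn1984, §3] -/
theorem exists_chimneyBend {K₀ : ℝ} (hK₀ : ∀ x, |deriv Real.smoothTransition x| ≤ K₀)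
    {θ₁ r_b t_b t₂ T₁ : ℝ} (hθ₁0 : 0 < θ₁) (hθ₁ : θ₁ < Real.pi / 2) (ht₂ : t_b ≤ t₂) (hT₁ : 0 < T₁) :
    ∃ (ρ : ℝ → ℝ) (ρinf : ℝ), ContDiff ℝ ∞ ρ ∧
      (∀ t, t ≤ t₂ → ρ t = r_b - Real.cot θ₁ * (t - t_b)) ∧
      (∀ t, HasDerivAt ρ (deriv ρ t) t) ∧ (∀ t, deriv ρ t ∈ Icc (-Real.cot θ₁) 0) ∧
      (∀ t, t₂ + T₁ ≤ t → ρ t = ρinf) ∧ r_b - Real.cot θ₁ * (t₂ + T₁ - t_b) ≤ ρinf ∧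
      (∀ t, t_b ≤ t → ρ t ≤ r_b) ∧ (∀ t, ρinf ≤ ρ t ∨ t ≤ t_b) ∧
      (∀ t, HasDerivAt (deriv ρ) (deriv (deriv ρ) t) t) ∧
      ∀ t, deriv (deriv ρ) t ∈ Icc 0 (Real.cot θ₁ * K₀ / T₁) := by
  have hcot : 0 < Real.cot θ₁ := by
    rw [Real.cot_eq_cos_div_sin]
    exact div_pos (Real.cos_pos_of_mem_Ioo ⟨by linarith, hθ₁⟩)
      (Real.sin_pos_of_pos_of_lt_pi hθ₁0 (by linarith [Real.pi_pos]))
  obtain ⟨S, hSc, hSanti, hS01, hS1, hS0, hSder, hSder'⟩ :=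
    exists_stepDown hK₀ (show t₂ < t₂ + T₁ by linarith)
  obtain ⟨hPc, hPder⟩ := contDiff_primitive hSc
  set P : ℝ → ℝ := fun t => ∫ w in (0 : ℝ)..t, S w with hP
  -- `ρ t = r_b - cot θ₁ (P t - P t_b)`
  set ρ : ℝ → ℝ := fun t => r_b - Real.cot θ₁ * (P t - P t_b) with hρ
  have hρder : ∀ t, HasDerivAt ρ (-(Real.cot θ₁ * S t)) t := fun t => by
    have h := ((hPder t).sub_const (P t_b)).const_mul (Real.cot θ₁) |>.const_sub r_b
    simpa using h
  have hderiv : ∀ t, deriv ρ t = -(Real.cot θ₁ * S t) := fun t => (hρder t).deriv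
  have hSi : ∀ x y, IntervalIntegrable S volume x y := fun x y => hSc.continuous.intervalIntegrable _ _
  -- `P t - P t_b = t - t_b` for `t ≤ t₂`... via `S = 1` on `(-∞, t₂]`
  have hPsub : ∀ x y, P y - P x = ∫ w in x..y, S w := fun x y => by
    show (∫ w in (0 : ℝ)..y, S w) - ∫ w in (0 : ℝ)..x, S w = ∫ w in x..y, S w
    rw [integral_interval_sub_left (hSi 0 y) (hSi 0 x)]
  have hlin : ∀ t, t ≤ t₂ → ρ t = r_b - Real.cot θ₁ * (t - t_b) := by
    intro t ht
    show r_b - Real.cot θ₁ * (P t - P t_b) = _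
    rw [hPsub]
    have : ∫ w in t_b..t, S w = ∫ w in t_b..t, (1 : ℝ) :=
      integral_congr fun w hw => hS1 w (by
        rcases le_total t_b t with h | h
        · rw [uIcc_of_le h] at hw; exact hw.2.trans ht
        · rw [uIcc_of_ge h] at hw; exact hw.2.trans ht₂)
    rw [this, intervalIntegral.integral_const, smul_eq_mul, mul_one]
  -- constancy beyond `t₂ + T₁`
  set ρinf : ℝ := ρ (t₂ + T₁) with hρinf
  have hconst : ∀ t, t₂ + T₁ ≤ t → ρ t = ρinf := by
    intro t ht
    show r_b - Real.cot θ₁ * (P t - P t_b) = r_b - Real.cot θ₁ * (P (t₂ + T₁) - P t_b)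
    have h0 : P t - P (t₂ + T₁) = 0 := by
      rw [hPsub]
      have : ∫ w in (t₂ + T₁)..t, S w = ∫ w in (t₂ + T₁)..t, (0 : ℝ) :=
        integral_congr fun w hw => hS0 w (by rw [uIcc_of_le ht] at hw; exact hw.1)
      rw [this, intervalIntegral.integral_const, smul_eq_mul, mul_zero]
    have : P t = P (t₂ + T₁) := by linarith
    rw [this]
  -- monotonicity
  have hanti : Antitone ρ := antitone_of_hasDerivAt_nonpos hρder fun t => by
    show -(Real.cot θ₁ * S t) ≤ 0
    have := (hS01 t).1
    nlinarith
  have hρinfle : ∀ t, ρinf ≤ ρ t := by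
    intro t
    rcases le_or_gt t (t₂ + T₁) with h | h
    · exact hanti h
    · rw [hconst t h.le]
  -- second derivative
  have hderiv_fun : deriv ρ = fun t => -(Real.cot θ₁ * S t) := funext hderiv
  have hρ'' : ∀ t, HasDerivAt (deriv ρ) (-(Real.cot θ₁ * deriv S t)) t := fun t => by
    rw [hderiv_fun]
    exact ((hSder' t).differentiableAt.hasDerivAt.const_mul (Real.cot θ₁)).neg
  have hderiv2 : ∀ t, deriv (deriv ρ) t = -(Real.cot θ₁ * deriv S t) := fun t => (hρ'' t).deriv
  have hS'nonpos : ∀ t, deriv S t ≤ 0 := fun t => hSanti.deriv_nonpos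
  have hS'bound : ∀ t, -(K₀ / T₁) ≤ deriv S t := fun t => by
    have := hSder t
    rw [add_sub_cancel_left] at this
    exact (abs_le.1 this).1
  refine ⟨ρ, ρinf, ?_, hlin, fun t => (hρder t).differentiableAt.hasDerivAt, fun t => ?_, hconst, ?_,
    fun t ht => ?_, fun t => Or.inl (hρinfle t), fun t => (hρ'' t).differentiableAt.hasDerivAt,
    fun t => ?_⟩
  · exact contDiff_const.sub (contDiff_const.mul (hPc.sub contDiff_const))
  · rw [hderiv]
    obtain ⟨h0, h1⟩ := hS01 t
    constructor <;> nlinarith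
  · -- `ρinf ≥ r_b - cot θ₁ (t₂ + T₁ - t_b)`
    show r_b - Real.cot θ₁ * (t₂ + T₁ - t_b) ≤ r_b - Real.cot θ₁ * (P (t₂ + T₁) - P t_b)
    have hle : P (t₂ + T₁) - P t_b ≤ t₂ + T₁ - t_b := by
      rw [hPsub]
      have h1 : ∫ w in t_b..(t₂ + T₁), S w ≤ ∫ w in t_b..(t₂ + T₁), (1 : ℝ) :=
        intervalIntegral.integral_mono_on (by linarith) (hSi _ _) intervalIntegrable_const
          fun w _ => (hS01 w).2
      rwa [intervalIntegral.integral_const, smul_eq_mul, mul_one] at h1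
    nlinarith
  · -- `ρ t ≤ r_b` for `t ≥ t_b`
    show r_b - Real.cot θ₁ * (P t - P t_b) ≤ r_b
    have h0 : 0 ≤ P t - P t_b := by
      rw [hPsub]
      exact intervalIntegral.integral_nonneg ht fun w _ => (hS01 w).1
    nlinarith
  · rw [hderiv2]
    have h1 := hS'nonpos t
    have h2 := hS'bound t
    constructor
    · nlinarith
    · have : -(Real.cot θ₁ * deriv S t) = Real.cot θ₁ * (-deriv S t) := by ring
      rw [this, mul_div_assoc]
      exact mul_le_mul_of_nonneg_left (by linarith) hcot.le

/-! ### From the profile to the frame sums of the flat model -/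

/-- **The frame sum of the graph zone in terms of the angle.**  If `τ' = -tan θ` near `r` with
`θ` differentiable at `r` and `cos θ(r) ≠ 0`, then
`-τ''(r)/(1 + τ'(r)²) - κ τ'(r)/r = (cos θ(r) θ'(r) + κ sin θ(r)/r) / cos θ(r)`
— the frame sum of `MeanConvexGraphHessian.frameSum_graphFun` equals the flat-model mean
curvature of `exists_angleProfile` divided by `cos θ`. [folklore] -/
theorem frameSum_graph_eq_of_angle {θ τ : ℝ → ℝ} {r θ' κ : ℝ}
    (hτ : ∀ᶠ s in 𝓝 r, HasDerivAt τ (-Real.tan (θ s)) s) (hθ : HasDerivAt θ θ' r)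
    (hcos : Real.cos (θ r) ≠ 0) :
    -(deriv (deriv τ) r / (1 + deriv τ r ^ 2)) - κ * deriv τ r / r =
      (Real.cos (θ r) * θ' + κ * Real.sin (θ r) / r) / Real.cos (θ r) := by
  -- `τ' = -tan θ` as functions near `r`, hence `τ'' = -θ'/cos² θ`
  have hτ'ev : deriv τ =ᶠ[𝓝 r] fun s => -Real.tan (θ s) := hτ.mono fun s hs => hs.deriv
  have hτ' : deriv τ r = -Real.tan (θ r) := hτ'ev.self_of_nhds
  have htan : HasDerivAt (fun s => -Real.tan (θ s)) (-(1 / Real.cos (θ r) ^ 2 * θ')) r :=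
    ((Real.hasDerivAt_tan hcos).comp r hθ).neg
  have hτ'' : deriv (deriv τ) r = -(1 / Real.cos (θ r) ^ 2 * θ') := by
    rw [hτ'ev.deriv_eq]; exact htan.deriv
  rw [hτ', hτ'', Real.tan_eq_sin_div_cos]
  have hc2 : Real.cos (θ r) ^ 2 ≠ 0 := pow_ne_zero 2 hcos
  have h1 : 1 + (-(Real.sin (θ r) / Real.cos (θ r))) ^ 2 = 1 / Real.cos (θ r) ^ 2 := by
    rw [neg_sq, div_pow]
    have := Real.sin_sq_add_cos_sq (θ r)
    field_simp
    linarith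
  rw [h1]
  field_simp
  ring

/-- **Positivity of the graph-zone frame sum on the middle zone**: with the bound
`κ sin θ/r + cos θ θ' ≥ (κ - β') sin θ/r` of `exists_angleProfile` (`0 < β' < κ`, `sin θ > 0`,
`0 < cos θ`), the frame sum is `≥ (κ - β') sin θ / (r cos θ) > 0`. [folklore] -/
theorem frameSum_graph_pos_of_angle {θ τ : ℝ → ℝ} {r θ' κ β' : ℝ} (hr : 0 < r)
    (hτ : ∀ᶠ s in 𝓝 r, HasDerivAt τ (-Real.tan (θ s)) s) (hθ : HasDerivAt θ θ' r)
    (hcos : 0 < Real.cos (θ r)) (hsin : 0 < Real.sin (θ r)) (hβ' : β' < κ)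
    (hbound : (κ - β') * Real.sin (θ r) / r ≤ κ * Real.sin (θ r) / r + Real.cos (θ r) * θ') :
    0 < -(deriv (deriv τ) r / (1 + deriv τ r ^ 2)) - κ * deriv τ r / r := by
  rw [frameSum_graph_eq_of_angle hτ hθ hcos.ne']
  refine div_pos ?_ hcos
  have : 0 < (κ - β') * Real.sin (θ r) / r := div_pos (mul_pos (by linarith) hsin) hr
  linarith

/-- **Positivity of the chimney frame sum**: if `0 ≤ ρ''` (bending towards the vertical),
`ρ'' ≤ B`, `0 < ρ ≤ r_b` and `r_b B < k - 1`, then `2 (k - 1) - 2 ρ ρ''/(1 + ρ'²) > 0` — the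
frame sum of `MeanConvexGraphHessian.frameSum_chimneyFun` with the bend of `exists_chimneyBend`
(`B = cot θ₁ K₀ / T₁`). [folklore] -/
theorem frameSum_chimney_pos {k ρ₀ ρ₁ ρ₂ r_b B : ℝ} (hρ₀ : 0 < ρ₀) (hρ₀b : ρ₀ ≤ r_b)
    (hρ₂ : 0 ≤ ρ₂) (hρ₂B : ρ₂ ≤ B) (hB : r_b * B < k - 1) :
    0 < 2 * (k - 1) - 2 * ρ₀ * ρ₂ / (1 + ρ₁ ^ 2) := by
  have h1 : 0 < 1 + ρ₁ ^ 2 := by positivity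
  have h2 : ρ₀ * ρ₂ / (1 + ρ₁ ^ 2) ≤ ρ₀ * ρ₂ := by
    rw [div_le_iff₀ h1]
    have : 0 ≤ ρ₀ * ρ₂ := by positivity
    nlinarith
  have h3 : ρ₀ * ρ₂ ≤ r_b * B := mul_le_mul hρ₀b hρ₂B hρ₂ (hρ₀.le.trans hρ₀b)
  have h4 : 2 * ρ₀ * ρ₂ / (1 + ρ₁ ^ 2) = 2 * (ρ₀ * ρ₂ / (1 + ρ₁ ^ 2)) := by ring
  rw [h4]
  linarith

end Literature.Geometry.Riemannian

end
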